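import Summits.AtomisticToContinuum.FouriersLaw.Theorems.BondHeatUncertaintyExtensiveSnapshotIrreversibilityEnergyWindowSkeletonWeights

/-!
# Energy window, part T-b (file 1 of 3) — coordinates, the pointwise transfer identity, entrywise
matrix calculus

Lineage `stmt-AtomisticToContinuum-9121` (`ExtensiveSnapshotIrreversibility`), K_fix half, leaf S3
`KernelTemperatureLipschitz`; record S3 ⟸ (Dˢ) ∧ (G1ℓ) ∧ (G1*ᶜᶜ) [Rᵇ], (G1ℓ) ⟸ (SWM) ∧ (JM),
(G1*ᶜᶜ) ⟸ (SWM) (glue parts S–V).  Cell decomp-a2c, lens «grading / quantitative ladder», generation 79,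
part T «SkeletonIdentities» (critic rows 1077 (d), 1086 (c), 1093 (g)) = five files: T-a
`…SkeletonVariation` (§1–§3, §6) → `…SkeletonJacobianMoments` (§4–§5) and T-b `…SkeletonCoordinates`
(§1–§3) → `…SkeletonRegularity` (§4) → `…SkeletonIdentities` (§5–§6); section numbers refer to the
part (T-a resp. T-b) as a whole.

PART T-b is the EXACT ALGEBRA of the skeleton route to `(G1*ᶜᶜ)` / `(G1ℓ)`: with `E = E^{s}_{m,z,r}` the
time-`s` skeleton flow map (R `skelFlowMapAt`), `J` its Jacobian matrix, `Γ = 2^{-m} J Jᵀ`, `a = (Γ+κ)⁻¹ c`,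
`u = Jᵀ a` (R: `skelJacAt`, `skelGramAt`, `regInv`, `skelCtrl…`, `skelField…`) and ANY continuous linear
functional `ℓ` on phase space,
`2^{-m} Σ_j ℓ(D E(x) b_j) · u_j(x) = ℓ(c♯) − κ ℓ(a♯)`                        (§2, pointwise, `κ > 0`)
(`♯ = ofCoordV`; linear algebra: `J Jᵀ a = 2^m Γ a = 2^m (c − κ a)` by `(Γ+κ)(Γ+κ)⁻¹ = 1`).  THIS FILE:
* §1 coordinates are linear (`coordV_add/_smul`, `ofCoordV_add/_smul/_sub`, `coordVLinear`), smooth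
  (`contDiff_/continuous_coordV_apply`), `ofCoordV_momCoord` (`e_{p_b}♯ = (0, single b 1)`), the
  Jacobian acts by columns (`coordV_apply_sum_smul_basisX`) and `Σ_j ℓ(L b_j)(aJ)_j = ℓ((J Jᵀ a)♯)`
  (`sum_mul_vecMul_jacMat`);
* §2 `gramMat_fderiv_skelFlowMapAt_eq` (`J Jᵀ = 2^m Γ`), `skelGramAt_mulVec_regInv_mulVec`
  (`Γ(Γ+κ)⁻¹c = c − κ(Γ+κ)⁻¹c`), ★ `inv_mul_sum_apply_fderiv_mul_vecMul` (the display above);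
* §3 generic ENTRYWISE calculus (any finite index type): `det`, `adjugate` and the inverse of a matrix
  field are measurable / `C^n` when the entries are (`measurable_/contDiff_{det, adjugate_apply,
  inv_apply}_of_entries`; the inverse needs `det ≠ 0` everywhere) — `Matrix n n ℝ` carries no
  `MeasurableSpace` instance, so the statements are entrywise.
Files 2–3 (`…SkeletonRegularity`, `…SkeletonIdentities`): regularity of R's objects in the skeleton
variable, then the arrival / departure identities and the kernel-side rewrites.
No instance / notation / option; no proof holes.
References: D. Nualart, The Malliavin Calculus and Related Topics (2006), Prop. 1.3.1, §2.3;
N. Cuneo, J.-P. Eckmann, M. Hairer, L. Rey-Bellet, Electron. J. Probab. 23 (2018), §3 eq. (3.4)–(3.6);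
R. Horn, C. Johnson, Matrix Analysis, §0.8 (adjugate / Cramer). [folklore]
-/

noncomputable section

namespace Summit.AtomisticToContinuum.FouriersLaw.Theorems.ExtensiveSnapshotIrreversibility.EnergyWindow

open MeasureTheory ProbabilityTheory Filter Topology Set
open scoped ENNReal NNReal Matrix ContDiff
open Literature.MathematicalPhysics.KineticTheory.HeatConduction
open Literature.Probability.Process

/-! ## 1. Coordinates are linear; the Jacobian acts by columns -/

section Coord

variable (N : ℕ) (m : ℕ)

/-- `coordV` is additive. [folklore] -/
theorem coordV_add (v w : PhaseSpace N) : coordV N (v + w) = coordV N v + coordV N w := by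
  funext a; cases a <;> rfl

/-- `coordV` is homogeneous. [folklore] -/
theorem coordV_smul (c : ℝ) (v : PhaseSpace N) : coordV N (c • v) = c • coordV N v := by
  funext a; cases a <;> rfl

/-- `ofCoordV` is additive. [folklore] -/
theorem ofCoordV_add (g h : Fin N ⊕ Fin N → ℝ) :
    ofCoordV N (g + h) = ofCoordV N g + ofCoordV N h :=
  coordV_injective N (by rw [coordV_add, coordV_ofCoordV, coordV_ofCoordV, coordV_ofCoordV])

/-- `ofCoordV` is homogeneous. [folklore] -/
theorem ofCoordV_smul (c : ℝ) (g : Fin N ⊕ Fin N → ℝ) : ofCoordV N (c • g) = c • ofCoordV N g :=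
  coordV_injective N (by rw [coordV_smul, coordV_ofCoordV, coordV_ofCoordV])

/-- `ofCoordV` respects subtraction. [folklore] -/
theorem ofCoordV_sub (g h : Fin N ⊕ Fin N → ℝ) :
    ofCoordV N (g - h) = ofCoordV N g - ofCoordV N h := by
  rw [sub_eq_add_neg, ofCoordV_add, ← neg_one_smul ℝ h, ofCoordV_smul, neg_one_smul,
    sub_eq_add_neg]

/-- `coordV` as a linear map (for `map_sum`). [folklore] -/
def coordVLinear : PhaseSpace N →ₗ[ℝ] (Fin N ⊕ Fin N → ℝ) where
  toFun := coordV N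
  map_add' := coordV_add N
  map_smul' := coordV_smul N

/-- Unfolding `coordVLinear`. [folklore] -/
@[simp] theorem coordVLinear_apply (v : PhaseSpace N) : coordVLinear N v = coordV N v := rfl

/-- Each coordinate is a smooth function on phase space. [folklore] -/
theorem contDiff_coordV_apply {n : WithTop ℕ∞} (a : Fin N ⊕ Fin N) :
    ContDiff ℝ n fun v : PhaseSpace N => coordV N v a := by
  rcases a with i | i
  · exact (contDiff_apply ℝ ℝ i).comp contDiff_fst
  · exact (contDiff_apply ℝ ℝ i).comp contDiff_snd

/-- Each coordinate is a continuous function on phase space. [folklore] -/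
theorem continuous_coordV_apply (a : Fin N ⊕ Fin N) :
    Continuous fun v : PhaseSpace N => coordV N v a :=
  (contDiff_coordV_apply N (n := 0) a).continuous

/-- The momentum direction `(0, e_b)` has coordinate vector `momCoord b`, i.e.
`ofCoordV (momCoord b) = (0, e_b)`. [folklore] -/
theorem ofCoordV_momCoord (b : Fin N) :
    ofCoordV N (momCoord N b) = (((0 : Fin N → ℝ), Pi.single b 1) : PhaseSpace N) := by
  rw [← coordV_momentum_single, ofCoordV_coordV]

variable {N m}

/-- **The Jacobian acts by columns**: the coordinates of `L (Σ_j w_j b_j)` are `J w`. [folklore] -/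
theorem coordV_apply_sum_smul_basisX (L : PairSkeleton m →ₗ[ℝ] PhaseSpace N)
    (w : Fin (2 ^ m) ⊕ Fin (2 ^ m) → ℝ) :
    coordV N (L (∑ j, w j • basisX m j)) = jacMat L *ᵥ w := by
  have h1 : coordV N (L (∑ j, w j • basisX m j)) = ∑ j, w j • coordV N (L (basisX m j)) := by
    rw [map_sum, ← coordVLinear_apply, map_sum]
    refine Finset.sum_congr rfl fun j _ => ?_
    rw [map_smul, map_smul, coordVLinear_apply]
  funext a
  rw [h1, Finset.sum_apply]
  simp only [Pi.smul_apply, smul_eq_mul, Matrix.mulVec, dotProduct, jacMat]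
  exact Finset.sum_congr rfl fun j _ => mul_comm _ _

/-- **`Σ_j ℓ(L b_j) (a J)_j = ℓ((J Jᵀ a)♯)`** for a linear functional `ℓ` on phase space.
[folklore] -/
theorem sum_mul_vecMul_jacMat (L : PairSkeleton m →ₗ[ℝ] PhaseSpace N) (ℓ : PhaseSpace N →L[ℝ] ℝ)
    (a : Fin N ⊕ Fin N → ℝ) :
    ∑ j, ℓ (L (basisX m j)) * (a ᵥ* jacMat L) j = ℓ (ofCoordV N (gramMat L *ᵥ a)) := by
  have h1 : ∑ j, ℓ (L (basisX m j)) * (a ᵥ* jacMat L) j =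
      ℓ (L (∑ j, (a ᵥ* jacMat L) j • basisX m j)) := by
    rw [map_sum, map_sum]
    refine Finset.sum_congr rfl fun j _ => ?_
    rw [map_smul, map_smul, smul_eq_mul, mul_comm]
  have h2 : L (∑ j, (a ᵥ* jacMat L) j • basisX m j) = ofCoordV N (gramMat L *ᵥ a) := by
    apply coordV_injective N
    rw [coordV_ofCoordV, coordV_apply_sum_smul_basisX, gramMat, ← Matrix.mulVec_mulVec,
      Matrix.mulVec_transpose]
  rw [h1, h2]

end Coord

/-! ## 2. The pointwise transfer identity for the regularised controls -/

section Transfer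

variable {ω₂ lam β γ : ℝ} {N : ℕ} {T_L T_R : ℝ} {s : ℝ} {m : ℕ}

/-- `J Jᵀ = 2^m Γ` (R `skelGramAt_eq_smul_gramMat`). [folklore] -/
theorem gramMat_fderiv_skelFlowMapAt_eq (z : PhaseSpace N) (r : WienerPair) (x : PairSkeleton m) :
    gramMat (fderiv ℝ (skelFlowMapAt ω₂ lam β γ N T_L T_R s m z r) x :
        PairSkeleton m →ₗ[ℝ] PhaseSpace N) =
      ((2 : ℝ) ^ m) • skelGramAt ω₂ lam β γ N T_L T_R s m z r x := by
  rw [skelGramAt_eq_smul_gramMat, smul_inv_smul₀ (pow_ne_zero _ two_ne_zero)]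

/-- **`Γ (Γ+κ)⁻¹ c = c − κ (Γ+κ)⁻¹ c`** for `κ > 0` (R `self_mul_regInv`): the regularised control
reproduces the target up to the EXACT defect `κ a`. [folklore] -/
theorem skelGramAt_mulVec_regInv_mulVec {κ : ℝ} (hκ : 0 < κ) (z : PhaseSpace N) (r : WienerPair)
    (x : PairSkeleton m) (c : Fin N ⊕ Fin N → ℝ) :
    skelGramAt ω₂ lam β γ N T_L T_R s m z r x *ᵥ
        (regInv (skelGramAt ω₂ lam β γ N T_L T_R s m z r x) κ *ᵥ c) =
      c - κ • (regInv (skelGramAt ω₂ lam β γ N T_L T_R s m z r x) κ *ᵥ c) := by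
  have h := self_mul_regInv (ω₂ := ω₂) (lam := lam) (β := β) (γ := γ) (N := N) (T_L := T_L)
    (T_R := T_R) (s := s) hκ z r x
  have h' : (skelGramAt ω₂ lam β γ N T_L T_R s m z r x + κ • (1 : Matrix _ _ ℝ)) *ᵥ
      (regInv (skelGramAt ω₂ lam β γ N T_L T_R s m z r x) κ *ᵥ c) = c := by
    rw [Matrix.mulVec_mulVec, h, Matrix.one_mulVec]
  rw [Matrix.add_mulVec, Matrix.smul_mulVec, Matrix.one_mulVec] at h'
  exact eq_sub_of_add_eq h'

/-- ★ **The pointwise transfer identity.**  For `κ > 0`, any coordinate target `c`, the regularised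
control `a = (Γ+κ)⁻¹ c`, the field `u = Jᵀ a = a J` and ANY continuous linear functional `ℓ` on phase
space: `2^{-m} Σ_j ℓ(D E(x) b_j) u_j = ℓ(c♯) − κ ℓ(a♯)`. [folklore] [cite: Nualart2006, §2.3] -/
theorem inv_mul_sum_apply_fderiv_mul_vecMul (κ : ℝ) (hκ : 0 < κ) (z : PhaseSpace N) (r : WienerPair)
    (x : PairSkeleton m) (c : Fin N ⊕ Fin N → ℝ) (ℓ : PhaseSpace N →L[ℝ] ℝ) :
    ((2 : ℝ) ^ m)⁻¹ * ∑ j, ℓ (fderiv ℝ (skelFlowMapAt ω₂ lam β γ N T_L T_R s m z r) x (basisX m j)) *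
        ((regInv (skelGramAt ω₂ lam β γ N T_L T_R s m z r x) κ *ᵥ c) ᵥ*
          skelJacAt ω₂ lam β γ N T_L T_R s m z r x) j =
      ℓ (ofCoordV N c) -
        κ * ℓ (ofCoordV N (regInv (skelGramAt ω₂ lam β γ N T_L T_R s m z r x) κ *ᵥ c)) := by
  set a := regInv (skelGramAt ω₂ lam β γ N T_L T_R s m z r x) κ *ᵥ c with ha
  have h1 : ∑ j, ℓ (fderiv ℝ (skelFlowMapAt ω₂ lam β γ N T_L T_R s m z r) x (basisX m j)) *
      (a ᵥ* skelJacAt ω₂ lam β γ N T_L T_R s m z r x) j =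
      ℓ (ofCoordV N (gramMat (fderiv ℝ (skelFlowMapAt ω₂ lam β γ N T_L T_R s m z r) x :
        PairSkeleton m →ₗ[ℝ] PhaseSpace N) *ᵥ a)) :=
    sum_mul_vecMul_jacMat (fderiv ℝ (skelFlowMapAt ω₂ lam β γ N T_L T_R s m z r) x :
      PairSkeleton m →ₗ[ℝ] PhaseSpace N) ℓ a
  have h2 : gramMat (fderiv ℝ (skelFlowMapAt ω₂ lam β γ N T_L T_R s m z r) x :
        PairSkeleton m →ₗ[ℝ] PhaseSpace N) *ᵥ a = ((2 : ℝ) ^ m) • (c - κ • a) := by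
    rw [gramMat_fderiv_skelFlowMapAt_eq, Matrix.smul_mulVec, ha,
      skelGramAt_mulVec_regInv_mulVec hκ]
  rw [h1, h2, ofCoordV_smul, map_smul, ofCoordV_sub, map_sub, ofCoordV_smul, map_smul, smul_eq_mul,
    smul_eq_mul, inv_mul_cancel_left₀ (pow_ne_zero _ two_ne_zero)]

end Transfer

/-! ## 3. Entrywise calculus of the determinant, the adjugate and the inverse

`Matrix ι ι ℝ` carries no measurable structure and no norm in Mathlib's default instances; the
regularised inverse `(Γ+κ)⁻¹ = det⁻¹ • adj` is handled ENTRYWISE through the Leibniz formula. -/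

section Entrywise

variable {ι : Type} [Fintype ι] [DecidableEq ι]

/-- The determinant of a matrix of measurable functions is measurable. [folklore] -/
theorem measurable_det_of_entries {α : Type*} [MeasurableSpace α] {M : α → Matrix ι ι ℝ}
    (hM : ∀ a a', Measurable fun p => M p a a') : Measurable fun p => (M p).det := by
  simp_rw [Matrix.det_apply, Units.smul_def, zsmul_eq_mul]
  exact Finset.measurable_sum _ fun σ _ =>
    (Finset.measurable_prod _ fun i _ => hM (σ i) i).const_mul _

/-- The cofactors of a matrix of measurable functions are measurable. [folklore] -/
theorem measurable_adjugate_apply_of_entries {α : Type*} [MeasurableSpace α] {M : α → Matrix ι ι ℝ}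
    (hM : ∀ a a', Measurable fun p => M p a a') (k l : ι) :
    Measurable fun p => (M p).adjugate k l := by
  simp_rw [Matrix.adjugate_apply]
  refine measurable_det_of_entries fun a a' => ?_
  simp_rw [Matrix.updateRow_apply]
  by_cases h : a = l
  · simp only [h, if_true]; exact measurable_const
  · simp only [h, if_false]; exact hM a a'

/-- The entries of the inverse of a matrix of measurable functions are measurable
(`A⁻¹ = det⁻¹ • adj`, junk `0` where singular). [folklore] -/
theorem measurable_inv_apply_of_entries {α : Type*} [MeasurableSpace α] {M : α → Matrix ι ι ℝ}
    (hM : ∀ a a', Measurable fun p => M p a a') (k l : ι) :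
    Measurable fun p => (M p)⁻¹ k l := by
  simp_rw [Matrix.inv_def, Matrix.smul_apply, smul_eq_mul, Ring.inverse_eq_inv']
  exact (measurable_det_of_entries hM).inv.mul (measurable_adjugate_apply_of_entries hM k l)

variable {X : Type*} [NormedAddCommGroup X] [NormedSpace ℝ X] {n : WithTop ℕ∞}

/-- The determinant of a matrix of `C^n` functions is `C^n`. [folklore] -/
theorem contDiff_det_of_entries {M : X → Matrix ι ι ℝ} (hM : ∀ a a', ContDiff ℝ n fun x => M x a a') :
    ContDiff ℝ n fun x => (M x).det := by
  simp_rw [Matrix.det_apply, Units.smul_def, zsmul_eq_mul]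
  exact ContDiff.sum fun σ _ => contDiff_const.mul (contDiff_prod fun i _ => hM (σ i) i)

/-- The cofactors of a matrix of `C^n` functions are `C^n`. [folklore] -/
theorem contDiff_adjugate_apply_of_entries {M : X → Matrix ι ι ℝ}
    (hM : ∀ a a', ContDiff ℝ n fun x => M x a a') (k l : ι) :
    ContDiff ℝ n fun x => (M x).adjugate k l := by
  simp_rw [Matrix.adjugate_apply]
  refine contDiff_det_of_entries fun a a' => ?_
  simp_rw [Matrix.updateRow_apply]
  by_cases h : a = l
  · simp only [h, if_true]; exact contDiff_const
  · simp only [h, if_false]; exact hM a a'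

/-- The entries of the inverse of a matrix of `C^n` functions with nowhere-vanishing determinant are
`C^n`. [folklore] -/
theorem contDiff_inv_apply_of_entries {M : X → Matrix ι ι ℝ}
    (hM : ∀ a a', ContDiff ℝ n fun x => M x a a') (hdet : ∀ x, (M x).det ≠ 0) (k l : ι) :
    ContDiff ℝ n fun x => (M x)⁻¹ k l := by
  simp_rw [Matrix.inv_def, Matrix.smul_apply, smul_eq_mul, Ring.inverse_eq_inv']
  exact ((contDiff_det_of_entries hM).inv hdet).mul (contDiff_adjugate_apply_of_entries hM k l)

end Entrywise

end Summit.AtomisticToContinuum.FouriersLaw.Theorems.ExtensiveSnapshotIrreversibility.EnergyWindow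

end
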